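import Mathlib
import HarnessLib
import Summits.QuantumFields.YangMills.Theorems.PencilRigidityShellRigidityAngleBandLimitChart

/-!
# The periodic entire extension of the angular trace (helpers of stub `stub_angleBandLimit`,
crux `PencilRigidity.ShellRigidity`, line `thales-slit-exact-cone-type`, stmt-QuantumFields-11685)

Pure complex analysis for an ABSTRACT family of charts `H ε` (`ε > 0`) of a function `g : ℝ → ℝ`
at radius `t > 0`: each `H ε` is holomorphic on the lens `{ε < t cos(Re w) e^{-|Im w|}}` and equals
`g` at the real points `ε ≤ t cos α` (for the charts of the angular trace of a kernel these are
`AngleBandLimit.differentiableOn_chart` and `AngleBandLimit.chart_ofReal` of the file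
`PencilRigidityShellRigidityAngleBandLimitChart`).

* `charts_eqOn_rect` — two levels `ε₁, ε₂ ≤ (t/2)e^{-L}` agree on the rectangle
  `{|Re w| < π/3, |Im w| < L}` (identity theorem from the real interval).
* `differentiableOn_glued`, `glued_ofReal`, `glued_sub_half_pi` — the glued function
  `Φ₀(w) = H_{(t/2)e^{-|Im w|-1}}(w)` is holomorphic on the strip `|Re w| < π/3`, equals `g` on
  `(-π/3, π/3)`, and if `g(α + π/2) = g(α)` then `Φ₀(u - π/2) = Φ₀(u)` for `π/6 < Re u < π/3`.
* `ext_eq_of_abs_lt`, `differentiable_ext`, `ext_periodic`, `ext_ofReal`, `norm_ext_le` — reducing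
  `Re w` modulo `π/2` into `[-π/4, π/4)` (`toIcoDiv`) extends `Φ₀` to an ENTIRE `π/2`-periodic `Φ`
  with `Φ = g` on `ℝ`; if the charts are bounded by `C(1 + (t cos(Re w) e^{-|Im w|})^{-a})` then
  `‖Φ w‖ ≤ C(1 + (t/2)^{-a}) e^{a |Im w|}`.
* `stub_angleBandLimitExtension` — the packaged statement (registered sub-goal).

Folklore (analytic continuation along a strip and periodic extension); no definitions, no named
facts. Helpers live in the sub-namespace `AngleBandLimit`.
-/

noncomputable section

namespace Summit.QuantumFields.YangMills.Cruxes.ShellRigidity.ThalesSlitExactConeType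

open MeasureTheory Complex Real
open scoped InnerProductSpace BigOperators

namespace AngleBandLimit

open Set Filter Metric Topology

/-! ## Gluing the charts of an abstract family in the level -/

section Abstract

variable {g : ℝ → ℝ} {H : ℝ → ℂ → ℂ} {t C a : ℝ}

/-- **Two levels agree where both charts live.** If every chart `H ε` (`ε > 0`) is holomorphic on
its lens and equals `g` at the real points `ε ≤ t cos α`, then two charts of levels
`ε₁, ε₂ ≤ (t/2) e^{-L}` agree on the rectangle `{|Re w| < π/3, |Im w| < L}` (identity theorem from
the real interval `(-π/3, π/3)`). -/
theorem charts_eqOn_rect (ht : 0 < t)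
    (hH : ∀ ε : ℝ, 0 < ε →
      DifferentiableOn ℂ (H ε) {w : ℂ | ε < t * Real.cos w.re * Real.exp (-|w.im|)})
    (hreal : ∀ ε : ℝ, 0 < ε → ∀ α : ℝ, ε ≤ t * Real.cos α → H ε α = g α)
    {L ε₁ ε₂ : ℝ} (h₁ : 0 < ε₁) (h₂ : 0 < ε₂) (h₁L : ε₁ ≤ t / 2 * Real.exp (-L))
    (h₂L : ε₂ ≤ t / 2 * Real.exp (-L)) :
    EqOn (H ε₁) (H ε₂) {w : ℂ | |w.re| < π / 3 ∧ |w.im| < L} := by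
  rcases le_or_gt L 0 with hL | hL
  · exact fun w hw => absurd hw.2 (not_lt.2 (hL.trans (abs_nonneg _)))
  have hL1 : Real.exp (-L) ≤ 1 := by rw [Real.exp_le_one_iff]; linarith
  have hset : {w : ℂ | |w.re - 0| < π / 3 ∧ |w.im| < L} = {w : ℂ | |w.re| < π / 3 ∧ |w.im| < L} := by
    simp only [sub_zero]
  have hsub : ∀ {ε : ℝ}, ε ≤ t / 2 * Real.exp (-L) →
      {w : ℂ | |w.re - 0| < π / 3 ∧ |w.im| < L} ⊆
        {w : ℂ | ε < t * Real.cos w.re * Real.exp (-|w.im|)} := by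
    intro ε hεL w hw
    rw [hset] at hw
    exact hεL.trans_lt (level_gt_of_mem_rect ht hw.1 hw.2)
  have hre : ∀ {ε : ℝ}, 0 < ε → ε ≤ t / 2 * Real.exp (-L) → ∀ s : ℝ, |s - 0| < π / 3 →
      H ε s = g s := by
    intro ε hε hεL s hs
    rw [sub_zero] at hs
    refine hreal ε hε s (hεL.trans ?_)
    have h1 := half_lt_cos hs
    nlinarith [mul_le_mul_of_nonneg_left hL1 (by positivity : (0 : ℝ) ≤ t / 2)]
  have key := eqOn_rect_of_eqOn_real ((hH ε₁ h₁).mono (hsub h₁L)) ((hH ε₂ h₂).mono (hsub h₂L))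
    fun s hs => by rw [hre h₁ h₁L s hs, hre h₂ h₂L s hs]
  rwa [hset] at key

/-- **The glued function is holomorphic on the strip `|Re w| < π/3`.** With
`Φ₀(w) = H_{(t/2)e^{-|Im w|-1}}(w)`: near `w₀` all the levels used, and the level of `w₀`, are
`≤ (t/2) e^{-L}` with `L = |Im w₀| + 1/2`, so `Φ₀` is locally ONE chart (`charts_eqOn_rect`). -/
theorem differentiableOn_glued (ht : 0 < t)
    (hH : ∀ ε : ℝ, 0 < ε →
      DifferentiableOn ℂ (H ε) {w : ℂ | ε < t * Real.cos w.re * Real.exp (-|w.im|)})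
    (hreal : ∀ ε : ℝ, 0 < ε → ∀ α : ℝ, ε ≤ t * Real.cos α → H ε α = g α)
    {Φ₀ : ℂ → ℂ} (hΦ₀ : ∀ w, Φ₀ w = H (t / 2 * Real.exp (-(|w.im| + 1))) w) :
    DifferentiableOn ℂ Φ₀ {w : ℂ | |w.re| < π / 3} := by
  intro w₀ hw₀
  have hw₀' : |w₀.re| < π / 3 := hw₀
  have hε₁ : 0 < t / 2 * Real.exp (-(|w₀.im| + 1)) := by positivity
  have hN : ∀ᶠ w in 𝓝 w₀, |w.re| < π / 3 ∧ |w.im - w₀.im| < 1 / 2 := by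
    have h1 : IsOpen {w : ℂ | |w.re| < π / 3} := isOpen_lt (by fun_prop) continuous_const
    filter_upwards [h1.mem_nhds hw₀', Metric.ball_mem_nhds w₀ (by norm_num : (0 : ℝ) < 1 / 2)]
      with w hw1 hw2
    refine ⟨hw1, ?_⟩
    rw [Metric.mem_ball, dist_eq_norm] at hw2
    exact (Complex.sub_im w w₀ ▸ abs_im_le_norm (w - w₀)).trans_lt hw2
  have heq : Φ₀ =ᶠ[𝓝 w₀] H (t / 2 * Real.exp (-(|w₀.im| + 1))) := by
    filter_upwards [hN] with w hw
    obtain ⟨hw1, hw2⟩ := hw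
    have hw3 : |w.im| < |w₀.im| + 1 / 2 ∧ |w₀.im| - 1 / 2 < |w.im| := by
      have h3 := abs_sub_abs_le_abs_sub w.im w₀.im
      have h4 := abs_sub_abs_le_abs_sub w₀.im w.im
      rw [abs_sub_comm] at h4
      constructor <;> linarith
    rw [hΦ₀]
    refine charts_eqOn_rect ht hH hreal (L := |w₀.im| + 1 / 2) (by positivity) hε₁
      (mul_le_mul_of_nonneg_left (Real.exp_le_exp.2 (by linarith)) (by positivity))
      (mul_le_mul_of_nonneg_left (Real.exp_le_exp.2 (by linarith)) (by positivity))
      ⟨hw1, hw3.1⟩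
  have hmem : w₀ ∈ {w : ℂ | t / 2 * Real.exp (-(|w₀.im| + 1)) <
      t * Real.cos w.re * Real.exp (-|w.im|)} := by
    show t / 2 * Real.exp (-(|w₀.im| + 1)) < _
    calc t / 2 * Real.exp (-(|w₀.im| + 1)) < t / 2 * Real.exp (-|w₀.im|) :=
          mul_lt_mul_of_pos_left (Real.exp_lt_exp.2 (by linarith)) (by positivity)
      _ < _ := level_gt_of_re_lt ht hw₀'
  have hd : DifferentiableAt ℂ (H (t / 2 * Real.exp (-(|w₀.im| + 1)))) w₀ :=
    (hH _ hε₁).differentiableAt ((isOpen_lens t _).mem_nhds hmem)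
  exact (hd.congr_of_eventuallyEq heq).differentiableWithinAt

/-- The glued function equals `g` on the real interval `(-π/3, π/3)`. -/
theorem glued_ofReal (ht : 0 < t)
    (hreal : ∀ ε : ℝ, 0 < ε → ∀ α : ℝ, ε ≤ t * Real.cos α → H ε α = g α)
    {Φ₀ : ℂ → ℂ} (hΦ₀ : ∀ w, Φ₀ w = H (t / 2 * Real.exp (-(|w.im| + 1))) w) {s : ℝ}
    (hs : |s| < π / 3) : Φ₀ s = g s := by
  rw [hΦ₀, Complex.ofReal_im, abs_zero, zero_add]
  refine hreal _ (by positivity) s ?_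
  have h1 : Real.exp (-1 : ℝ) ≤ 1 := by rw [Real.exp_le_one_iff]; norm_num
  have h2 := half_lt_cos hs
  nlinarith [mul_le_mul_of_nonneg_left h1 (by positivity : (0 : ℝ) ≤ t / 2)]

/-- **Periodicity inside the strip.** If moreover `g(α + π/2) = g(α)`, then
`Φ₀(u - π/2) = Φ₀(u)` for `π/6 < Re u < π/3` (identity theorem on the rectangles centred at `π/4`
of half-width `π/12`: both sides are holomorphic there and agree at the real points). -/
theorem glued_sub_half_pi (ht : 0 < t)
    (hH : ∀ ε : ℝ, 0 < ε →
      DifferentiableOn ℂ (H ε) {w : ℂ | ε < t * Real.cos w.re * Real.exp (-|w.im|)})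
    (hreal : ∀ ε : ℝ, 0 < ε → ∀ α : ℝ, ε ≤ t * Real.cos α → H ε α = g α)
    (hper : ∀ α : ℝ, g (α + π / 2) = g α)
    {Φ₀ : ℂ → ℂ} (hΦ₀ : ∀ w, Φ₀ w = H (t / 2 * Real.exp (-(|w.im| + 1))) w) {u : ℂ}
    (hu1 : π / 6 < u.re) (hu2 : u.re < π / 3) : Φ₀ (u - (π / 2 : ℝ)) = Φ₀ u := by
  have hd := differentiableOn_glued ht hH hreal hΦ₀
  have key := eqOn_rect_of_eqOn_real (c := π / 4) (A := π / 12) (L := |u.im| + 1)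
    (f := fun w => Φ₀ (w - (π / 2 : ℝ))) (g := Φ₀) ?_ ?_ ?_
  · exact key ⟨by rw [abs_lt]; constructor <;> linarith, by linarith [abs_nonneg u.im]⟩
  · refine hd.comp ((differentiable_id.sub_const _).differentiableOn) fun w hw => ?_
    have h := abs_lt.1 hw.1
    show |(w - ((π / 2 : ℝ) : ℂ)).re| < π / 3
    rw [Complex.sub_re, Complex.ofReal_re, abs_lt]
    constructor <;> linarith
  · refine hd.mono fun w hw => ?_
    have h := abs_lt.1 hw.1
    show |w.re| < π / 3
    rw [abs_lt]
    constructor <;> linarith [Real.pi_pos]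
  · intro s hs
    have h := abs_lt.1 hs
    have e1 : ((s : ℂ) - ((π / 2 : ℝ) : ℂ)) = ((s - π / 2 : ℝ) : ℂ) := by push_cast; ring
    show Φ₀ ((s : ℂ) - ((π / 2 : ℝ) : ℂ)) = Φ₀ s
    rw [e1, glued_ofReal ht hreal hΦ₀ (by rw [abs_lt]; constructor <;> linarith [Real.pi_pos]),
      glued_ofReal ht hreal hΦ₀ (by rw [abs_lt]; constructor <;> linarith [Real.pi_pos])]
    have := hper (s - π / 2)
    rw [sub_add_cancel] at this
    rw [this]

/-! ## The periodic entire extension of an abstract family of charts -/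

/-- Reduction of the real part modulo `π/2`: `Re w - n π/2 ∈ [-π/4, π/4)` for
`n = toIcoDiv (π/2) (-π/4) (Re w)`. -/
theorem re_sub_toIcoDiv_mem (x : ℝ) :
    x - (toIcoDiv Real.pi_div_two_pos (-(π / 4)) x : ℝ) * (π / 2) ∈
      Ico (-(π / 4)) (-(π / 4) + π / 2) := by
  have h := sub_toIcoDiv_zsmul_mem_Ico Real.pi_div_two_pos (-(π / 4)) x
  rwa [zsmul_eq_mul] at h

/-- **The extension is locally a translate of the glued function.** With
`Φ(w) = Φ₀(w - n π/2)`, `n = toIcoDiv (π/2) (-π/4) (Re w)`: for every integer `k` with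
`|Re w - k π/2| < π/3` also `Φ(w) = Φ₀(w - k π/2)` (`k - n ∈ {-1, 0, 1}` and the periodicity of `Φ₀`
inside the strip, `glued_sub_half_pi`). -/
theorem ext_eq_of_abs_lt (ht : 0 < t)
    (hH : ∀ ε : ℝ, 0 < ε →
      DifferentiableOn ℂ (H ε) {w : ℂ | ε < t * Real.cos w.re * Real.exp (-|w.im|)})
    (hreal : ∀ ε : ℝ, 0 < ε → ∀ α : ℝ, ε ≤ t * Real.cos α → H ε α = g α)
    (hper : ∀ α : ℝ, g (α + π / 2) = g α)
    {Φ₀ : ℂ → ℂ} (hΦ₀ : ∀ w, Φ₀ w = H (t / 2 * Real.exp (-(|w.im| + 1))) w)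
    {Φ : ℂ → ℂ} (hΦ : ∀ w, Φ w =
      Φ₀ (w - (((toIcoDiv Real.pi_div_two_pos (-(π / 4)) w.re : ℝ) * (π / 2) : ℝ) : ℂ)))
    (w : ℂ) (k : ℤ) (hk : |w.re - k * (π / 2)| < π / 3) :
    Φ w = Φ₀ (w - (((k : ℝ) * (π / 2) : ℝ) : ℂ)) := by
  rw [hΦ]
  set n : ℤ := toIcoDiv Real.pi_div_two_pos (-(π / 4)) w.re with hn
  have hr := re_sub_toIcoDiv_mem w.re
  rw [← hn] at hr
  have hk' := abs_lt.1 hk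
  have hA : ((k : ℝ) - n) * (π / 2) < 2 * (π / 2) := by nlinarith [hr.2, hk'.1, Real.pi_pos]
  have hB : (-2) * (π / 2) < ((k : ℝ) - n) * (π / 2) := by nlinarith [hr.1, hk'.2, Real.pi_pos]
  have h1 : (k : ℝ) - n < 2 := lt_of_mul_lt_mul_right hA (by positivity)
  have h2 : (-2 : ℝ) < k - n := lt_of_mul_lt_mul_right hB (by positivity)
  have h1' : k - n < 2 := by exact_mod_cast h1
  have h2' : -2 < k - n := by exact_mod_cast h2
  obtain h | h | h : k = n - 1 ∨ k = n ∨ k = n + 1 := by omega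
  · -- `k = n - 1`: `w - n π/2 = (w - k π/2) - π/2` and `Re (w - k π/2) ∈ [π/4, π/3)`
    rw [h] at hk'
    push_cast at hk'
    have e : w - (((n : ℝ) * (π / 2) : ℝ) : ℂ) =
        (w - ((((n - 1 : ℤ) : ℝ) * (π / 2) : ℝ) : ℂ)) - ((π / 2 : ℝ) : ℂ) := by
      push_cast; ring
    rw [h, e]
    refine glued_sub_half_pi ht hH hreal hper hΦ₀ ?_ ?_
    · rw [Complex.sub_re, Complex.ofReal_re]; push_cast; linarith [hr.1, Real.pi_pos]
    · rw [Complex.sub_re, Complex.ofReal_re]; push_cast; linarith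
  · rw [h]
  · -- `k = n + 1`: `w - k π/2 = (w - n π/2) - π/2` and `Re (w - n π/2) ∈ (π/6, π/4)`
    rw [h] at hk'
    push_cast at hk'
    have e : w - ((((n + 1 : ℤ) : ℝ) * (π / 2) : ℝ) : ℂ) =
        (w - (((n : ℝ) * (π / 2) : ℝ) : ℂ)) - ((π / 2 : ℝ) : ℂ) := by
      push_cast; ring
    rw [h, e]
    refine (glued_sub_half_pi ht hH hreal hper hΦ₀ ?_ ?_).symm
    · rw [Complex.sub_re, Complex.ofReal_re]; linarith
    · rw [Complex.sub_re, Complex.ofReal_re]; linarith [hr.2, Real.pi_pos]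

/-- **The extension is entire**: near `w₀` it is the translate `Φ₀(· - n₀ π/2)` of the glued
function, holomorphic on the strip `|Re| < π/3` (`differentiableOn_glued`). -/
theorem differentiable_ext (ht : 0 < t)
    (hH : ∀ ε : ℝ, 0 < ε →
      DifferentiableOn ℂ (H ε) {w : ℂ | ε < t * Real.cos w.re * Real.exp (-|w.im|)})
    (hreal : ∀ ε : ℝ, 0 < ε → ∀ α : ℝ, ε ≤ t * Real.cos α → H ε α = g α)
    (hper : ∀ α : ℝ, g (α + π / 2) = g α)
    {Φ₀ : ℂ → ℂ} (hΦ₀ : ∀ w, Φ₀ w = H (t / 2 * Real.exp (-(|w.im| + 1))) w)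
    {Φ : ℂ → ℂ} (hΦ : ∀ w, Φ w =
      Φ₀ (w - (((toIcoDiv Real.pi_div_two_pos (-(π / 4)) w.re : ℝ) * (π / 2) : ℝ) : ℂ))) :
    Differentiable ℂ Φ := by
  intro w₀
  set n : ℤ := toIcoDiv Real.pi_div_two_pos (-(π / 4)) w₀.re with hn
  have hr := re_sub_toIcoDiv_mem w₀.re
  rw [← hn] at hr
  have heq : Φ =ᶠ[𝓝 w₀] fun w => Φ₀ (w - (((n : ℝ) * (π / 2) : ℝ) : ℂ)) := by
    filter_upwards [Metric.ball_mem_nhds w₀ (by positivity : (0 : ℝ) < π / 12)] with w hw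
    refine ext_eq_of_abs_lt ht hH hreal hper hΦ₀ hΦ w n ?_
    rw [Metric.mem_ball, dist_eq_norm] at hw
    have h1 : |w.re - w₀.re| < π / 12 :=
      (Complex.sub_re w w₀ ▸ abs_re_le_norm (w - w₀)).trans_lt hw
    have h2 := abs_lt.1 h1
    rw [abs_lt]
    constructor <;> linarith [hr.1, hr.2]
  refine DifferentiableAt.congr_of_eventuallyEq ?_ heq
  have hd := differentiableOn_glued ht hH hreal hΦ₀
  have hopen : IsOpen {w : ℂ | |w.re| < π / 3} := isOpen_lt (by fun_prop) continuous_const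
  have hmem : w₀ - (((n : ℝ) * (π / 2) : ℝ) : ℂ) ∈ {w : ℂ | |w.re| < π / 3} := by
    show |(w₀ - (((n : ℝ) * (π / 2) : ℝ) : ℂ)).re| < π / 3
    rw [Complex.sub_re, Complex.ofReal_re, abs_lt]
    constructor <;> linarith [hr.1, hr.2, Real.pi_pos]
  exact (hd.differentiableAt (hopen.mem_nhds hmem)).comp w₀ (differentiableAt_id.sub_const _)

/-- **The extension has period `π/2`.** -/
theorem ext_periodic (ht : 0 < t)
    (hH : ∀ ε : ℝ, 0 < ε →
      DifferentiableOn ℂ (H ε) {w : ℂ | ε < t * Real.cos w.re * Real.exp (-|w.im|)})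
    (hreal : ∀ ε : ℝ, 0 < ε → ∀ α : ℝ, ε ≤ t * Real.cos α → H ε α = g α)
    (hper : ∀ α : ℝ, g (α + π / 2) = g α)
    {Φ₀ : ℂ → ℂ} (hΦ₀ : ∀ w, Φ₀ w = H (t / 2 * Real.exp (-(|w.im| + 1))) w)
    {Φ : ℂ → ℂ} (hΦ : ∀ w, Φ w =
      Φ₀ (w - (((toIcoDiv Real.pi_div_two_pos (-(π / 4)) w.re : ℝ) * (π / 2) : ℝ) : ℂ)))
    (w : ℂ) : Φ (w + (π / 2 : ℝ)) = Φ w := by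
  set n : ℤ := toIcoDiv Real.pi_div_two_pos (-(π / 4)) w.re with hn
  have hr := re_sub_toIcoDiv_mem w.re
  rw [← hn] at hr
  rw [ext_eq_of_abs_lt ht hH hreal hper hΦ₀ hΦ (w + (π / 2 : ℝ)) (n + 1) ?_, hΦ w]
  · congr 1
    push_cast
    ring
  · have e : (w + ((π / 2 : ℝ) : ℂ)).re - ((n + 1 : ℤ) : ℝ) * (π / 2) = w.re - n * (π / 2) := by
      rw [Complex.add_re, Complex.ofReal_re]; push_cast; ring
    rw [e, abs_lt]
    constructor <;> linarith [hr.1, hr.2, Real.pi_pos]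

/-- **The extension restricts to `g` on `ℝ`** (`Φ₀ = g` on `(-π/3, π/3)` and `g` is periodic). -/
theorem ext_ofReal (ht : 0 < t)
    (hreal : ∀ ε : ℝ, 0 < ε → ∀ α : ℝ, ε ≤ t * Real.cos α → H ε α = g α)
    (hper : ∀ α : ℝ, g (α + π / 2) = g α)
    {Φ₀ : ℂ → ℂ} (hΦ₀ : ∀ w, Φ₀ w = H (t / 2 * Real.exp (-(|w.im| + 1))) w)
    {Φ : ℂ → ℂ} (hΦ : ∀ w, Φ w =
      Φ₀ (w - (((toIcoDiv Real.pi_div_two_pos (-(π / 4)) w.re : ℝ) * (π / 2) : ℝ) : ℂ)))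
    (θ : ℝ) : Φ θ = g θ := by
  rw [hΦ, Complex.ofReal_re]
  set n : ℤ := toIcoDiv Real.pi_div_two_pos (-(π / 4)) θ with hn
  have hr := re_sub_toIcoDiv_mem θ
  rw [← hn] at hr
  have e : (θ : ℂ) - (((n : ℝ) * (π / 2) : ℝ) : ℂ) = ((θ - n * (π / 2) : ℝ) : ℂ) := by push_cast; ring
  rw [e, glued_ofReal ht hreal hΦ₀ (by rw [abs_lt]; constructor <;> linarith [hr.1, hr.2, Real.pi_pos])]
  have hperg : Function.Periodic g (π / 2) := hper
  exact_mod_cast hperg.sub_int_mul_eq n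

/-- **Growth of the extension**: `‖Φ w‖ ≤ C(1 + (t/2)^{-a}) e^{a |Im w|}` (the chart bound at the
level `m ≥ (t/2) e^{-|Im w|}` of the reduced point). -/
theorem norm_ext_le (ht : 0 < t) (ha : 0 ≤ a) (hC : 0 ≤ C)
    (hbd : ∀ ε : ℝ, 0 < ε → ∀ w : ℂ, ε < t * Real.cos w.re * Real.exp (-|w.im|) →
      ‖H ε w‖ ≤ C * (1 + (t * Real.cos w.re * Real.exp (-|w.im|)) ^ (-a)))
    {Φ₀ : ℂ → ℂ} (hΦ₀ : ∀ w, Φ₀ w = H (t / 2 * Real.exp (-(|w.im| + 1))) w)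
    {Φ : ℂ → ℂ} (hΦ : ∀ w, Φ w =
      Φ₀ (w - (((toIcoDiv Real.pi_div_two_pos (-(π / 4)) w.re : ℝ) * (π / 2) : ℝ) : ℂ)))
    (w : ℂ) : ‖Φ w‖ ≤ C * (1 + (t / 2) ^ (-a)) * Real.exp (a * |w.im|) := by
  rw [hΦ, hΦ₀]
  set n : ℤ := toIcoDiv Real.pi_div_two_pos (-(π / 4)) w.re with hn
  have hr := re_sub_toIcoDiv_mem w.re
  rw [← hn] at hr
  set u : ℂ := w - (((n : ℝ) * (π / 2) : ℝ) : ℂ) with hu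
  have hure : u.re = w.re - n * (π / 2) := by rw [hu, Complex.sub_re, Complex.ofReal_re]
  have huim : u.im = w.im := by rw [hu, Complex.sub_im, Complex.ofReal_im, sub_zero]
  have hure' : |u.re| < π / 3 := by
    rw [hure, abs_lt]; constructor <;> linarith [hr.1, hr.2, Real.pi_pos]
  rw [huim]
  have hlow : t / 2 * Real.exp (-|w.im|) < t * Real.cos u.re * Real.exp (-|w.im|) := by
    have := level_gt_of_re_lt ht hure'
    rwa [huim] at this
  have hε : 0 < t / 2 * Real.exp (-(|w.im| + 1)) := by positivity
  have hεm : t / 2 * Real.exp (-(|w.im| + 1)) < t * Real.cos u.re * Real.exp (-|w.im|) :=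
    lt_trans (mul_lt_mul_of_pos_left (Real.exp_lt_exp.2 (by linarith)) (by positivity)) hlow
  have h1 := hbd _ hε u (by rw [huim]; exact hεm)
  rw [huim] at h1
  have hm0 : 0 < t / 2 * Real.exp (-|w.im|) := by positivity
  have h2 : (t * Real.cos u.re * Real.exp (-|w.im|)) ^ (-a) ≤ (t / 2 * Real.exp (-|w.im|)) ^ (-a) :=
    Real.rpow_le_rpow_of_nonpos hm0 hlow.le (by linarith)
  have h3 : (t / 2 * Real.exp (-|w.im|)) ^ (-a) = (t / 2) ^ (-a) * Real.exp (a * |w.im|) := by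
    rw [Real.mul_rpow (by positivity) (Real.exp_pos _).le, ← Real.exp_mul]
    congr 2
    ring
  have h4 : 1 ≤ Real.exp (a * |w.im|) := Real.one_le_exp (by positivity)
  have h5 : 0 ≤ (t / 2) ^ (-a) := Real.rpow_nonneg (by positivity) _
  rw [h3] at h2
  calc ‖H (t / 2 * Real.exp (-(|w.im| + 1))) u‖
      ≤ C * (1 + (t * Real.cos u.re * Real.exp (-|w.im|)) ^ (-a)) := h1
    _ ≤ C * (1 + (t / 2) ^ (-a) * Real.exp (a * |w.im|)) := by gcongr
    _ ≤ C * (1 + (t / 2) ^ (-a)) * Real.exp (a * |w.im|) := by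
        nlinarith [mul_nonneg hC h5, mul_nonneg hC (sub_nonneg.2 h4)]

end Abstract

end AngleBandLimit

/-! ## The periodic entire extension (registered sub-goal `stub_angleBandLimitExtension`) -/

open AngleBandLimit in
/-- **The periodic entire extension.** For an abstract family of charts `H ε` of `g` on the
lenses (holomorphic, equal to `g` at the real points `ε ≤ t cos α`, bounded by
`C(1 + (t cos(Re w) e^{-|Im w|})^{-a})`) with `g` of period `π/2`, there is an entire `π/2`-periodic
`Φ` of exponential type `a` in `Im w` restricting to `g` on `ℝ`: glue the levels
(`differentiableOn_glued`) and reduce `Re w` modulo `π/2` (`differentiable_ext`, `ext_periodic`,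
`norm_ext_le`, `ext_ofReal`). -/
theorem stub_angleBandLimitExtension (g : ℝ → ℝ) (H : ℝ → ℂ → ℂ) (t C a : ℝ) (ht : 0 < t)
    (ha : 0 ≤ a)
    (hH : ∀ ε : ℝ, 0 < ε →
      DifferentiableOn ℂ (H ε) {w : ℂ | ε < t * Real.cos w.re * Real.exp (-|w.im|)})
    (hreal : ∀ ε : ℝ, 0 < ε → ∀ α : ℝ, ε ≤ t * Real.cos α → H ε α = g α)
    (hbd : ∀ ε : ℝ, 0 < ε → ∀ w : ℂ, ε < t * Real.cos w.re * Real.exp (-|w.im|) →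
      ‖H ε w‖ ≤ C * (1 + (t * Real.cos w.re * Real.exp (-|w.im|)) ^ (-a)))
    (hper : ∀ α : ℝ, g (α + π / 2) = g α) :
    ∃ Φ : ℂ → ℂ, Differentiable ℂ Φ ∧ (∀ w : ℂ, Φ (w + (π / 2 : ℝ)) = Φ w) ∧
      (∀ w : ℂ, ‖Φ w‖ ≤ C * (1 + (t / 2) ^ (-a)) * Real.exp (a * |w.im|)) ∧
      ∀ θ : ℝ, Φ θ = g θ := by
  -- `C ≥ 0`: the bound at the level `t/2` at `w = 0`
  have hC : 0 ≤ C := by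
    have h0 : t / 2 < t * Real.cos (0 : ℂ).re * Real.exp (-|(0 : ℂ).im|) := by
      simp only [Complex.zero_re, Complex.zero_im, Real.cos_zero, abs_zero, neg_zero,
        Real.exp_zero, mul_one]
      linarith
    have h1 := hbd (t / 2) (by positivity) 0 h0
    have h2 : 0 < 1 + (t * Real.cos (0 : ℂ).re * Real.exp (-|(0 : ℂ).im|)) ^ (-a) := by
      have := Real.rpow_nonneg (by rw [Complex.zero_re, Real.cos_zero, mul_one]; positivity :
        (0 : ℝ) ≤ t * Real.cos (0 : ℂ).re * Real.exp (-|(0 : ℂ).im|)) (-a)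
      linarith
    by_contra hneg
    have := mul_neg_of_neg_of_pos (not_le.1 hneg) h2
    linarith [norm_nonneg (H (t / 2) 0)]
  set Φ₀ : ℂ → ℂ := fun w => H (t / 2 * Real.exp (-(|w.im| + 1))) w with hΦ₀def
  have hΦ₀ : ∀ w, Φ₀ w = H (t / 2 * Real.exp (-(|w.im| + 1))) w := fun w => rfl
  set Φ : ℂ → ℂ := fun w =>
    Φ₀ (w - (((toIcoDiv Real.pi_div_two_pos (-(π / 4)) w.re : ℝ) * (π / 2) : ℝ) : ℂ)) with hΦdef
  have hΦ : ∀ w, Φ w =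
      Φ₀ (w - (((toIcoDiv Real.pi_div_two_pos (-(π / 4)) w.re : ℝ) * (π / 2) : ℝ) : ℂ)) :=
    fun w => rfl
  exact ⟨Φ, differentiable_ext ht hH hreal hper hΦ₀ hΦ, ext_periodic ht hH hreal hper hΦ₀ hΦ,
    norm_ext_le ht ha hC hbd hΦ₀ hΦ, ext_ofReal ht hreal hper hΦ₀ hΦ⟩

end Summit.QuantumFields.YangMills.Cruxes.ShellRigidity.ThalesSlitExactConeType
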